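import Summits.NavierStokesRegularity.NavierStokesRegularity.Theorems.ScaledTopAlignmentFlexibleZoom
import Summits.NavierStokesRegularity.NavierStokesRegularity.Theorems.ScaledTopAlignmentExistsAnchorWindow
import Summits.NavierStokesRegularity.NavierStokesRegularity.Theorems.ScaledTopAlignmentMostTimesEnd
import Summits.NavierStokesRegularity.NavierStokesRegularity.Theorems.LocalSineTubeDoorProfileAlignedWindowRigidity
import Summits.NavierStokesRegularity.NavierStokesRegularity.Theorems.SymmetryModuliCountLiouvilleKillsTypeI
import Summits.NavierStokesRegularity.NavierStokesRegularity.Theses.TypeILiouville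
import Literature.Analysis.FluidPDE.VorticityCalculus
import HarnessLib
/-!
# Route `ScaledTopAlignment`: GLUE KIT for the RE-ANCHORED most-times door W3ᵐᵗ-∃e (support for the deciding
# crux W3ᵐᵗ = `AprioriMostTimesBulkAlignment`, stmt-NavierStokesRegularity-19551, and the planner's banked
# weaker door W3ᵐᵗ-∃e of cell rev21/; no import of the route file, so a future `closes` may cite everything here)

Tribunal T2 gen 6 (kit inspection, print map 82e220a54b665863) and J addendum 1: p5's most-times glue kit
(`ScaledTopAlignmentMostTimesGlueKit`, `false_of_mostTimesWindowBulkAligned_typeI`) uses the door's ANCHOR — the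
direction `ξ(t,x) = ω(t,x)/|ω(t,x)|` of the rate-near-max point, against which the misaligned bulk of its window is
measured — only in the window lemma, whose endgame `eq_zero_of_aligned_window` needs alignment with ANY fixed vector
on one open set. Hence the door may be RE-ANCHORED: «… → ∃ e, ‖e‖ = 1 ∧ volume {y | comparable ∧ in the window ∧
ε < sine(e, ξ(t,y))} ≤ δ ℓ³» (planner p3 g4, cell rev21/W3mtExistsAnchor.lean: `AprioriMostTimesBulkAlignmentExistsAnchor`,
signature rev21/W3mtE.signature.txt; dominance W3ᵐᵗ ⇒ W3ᵐᵗ-∃e with `e := ξ(t,x)`). The planner's MECHANICAL TRIGGER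
for adopting the weaker door (rev21/README.md) is a Theses-free bridge «W3ᵐᵗ-∃e → NoTypeII → NavierStokesRegularity»
ACCEPTED in Theorems/. This file is that bridge:

* `false_of_mostTimesBulkAlignedExistsAnchor_typeI` — the ∃e door at one solution kills Type-I blow-up. Steps 1–4
  are p5's verbatim (flexible Type-I zoom; non-unidirectional vorticity end; amplitude floor on a slice interval and
  the door along the levels `(ε_n, δ_n) = (1/(n+1), 1/(n+1))`; diagonal `n(j)` by `Nat.findGreatest`, slice
  selection off the exceptional sets, convergent slices). NEW in step 5: the door's anchors are turned into a unit
  ANCHOR FIELD `e_n(t,x)` by choice (a fixed unit vector where the clause is idle), and the window lemma with an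
  anchor field (`exists_window_cross_anchor_eq_zero_of_anchorBulkAligned_levels`, sibling file
  `ScaledTopAlignmentExistsAnchorWindow`: the anchors at the preimages of the base point subconverge on `S²`) makes
  the limit vorticity parallel to a fixed `e⋆ ≠ 0` on an open set; `eq_zero_of_aligned_window` forces `W ≡ 0`.
* `navierStokesRegularity_of_mostTimesBulkAlignmentExistsAnchor_of_noTypeII` — THE BRIDGE: hypothesis = the rev21
  door `AprioriMostTimesBulkAlignmentExistsAnchor` VERBATIM, plus NoTypeII (body of `TypeILiouville.TypeIliouvilleNoTypeII`)
  ⇒ `NavierStokesRegularity` (via `TypeILiouville.Assembly_holds` and the slab bound).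

WHAT THIS IS NOT: not NS regularity; nothing here proves any door; NoTypeII stays the residual hard core; by the door
calculus (`door_iff_target_of_kill_of_regular`) the re-anchored door is ≡ `ThreadingFlux.Target` modulo NoTypeII like
every member of the family — re-anchoring changes what a-priori estimates could FEED the door (mean-oscillation /
weighted-budget classes #1/#3 need no anchoring lemma), not its distance from the hard core.
References: Giga–Miura, CMP 303 (2011) = HUPS #956, Thm 1.1, Rmk 1.4, §2.1 [GigaMiura2011]; KNSS, Acta Math. 203
(2009), Thm 5.1, §6 [KochNadirashviliSereginSverak2009].
-/

noncomputable section
-- the summit and its single sub-problem share the name (CONVENTIONS §1), as in every Theorems file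
set_option linter.dupNamespace false
open MeasureTheory Set Function Filter Topology Metric
open scoped RealInnerProductSpace ENNReal
namespace Summit.NavierStokesRegularity.NavierStokesRegularity.Theorems
open Literature.Analysis Literature.Analysis.FluidPDE
open Summit.NavierStokesRegularity.NavierStokesRegularity.Theorems.LocalSineTubeDoorProfileAlignedWindowRigidity

/-! ### The kit -/

set_option maxHeartbeats 800000 in
/-- **A re-anchored most-times window-bulk door kills Type-I blow-up.** Let `(u, p)` be a classical solution on
`ℝ³ × [0, T)`, Leray–Hopf from `u 0`, bounded on every `[0, T'] × ℝ³` (`T' < T`), with the Type-I rate at `T` and no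
smooth extension past `T`. Suppose that for some `λ₀ < 1`, `R₀ > 0`, `θ < 1`, for EVERY rate threshold `κ > 0` and
all `ε, δ > 0` there are a level `M` and an exceptional time set `E` of final density `≤ θ` at `T` such that at every
`t ∈ [0,T) ∖ E` and every `x` with `|ω(t,x)| ≥ M`, `≥ κ/(T−t)` SOME unit vector `e` has the `ε`-misaligned (against
`e`) comparable-amplitude part of the window of volume `≤ δ √(ν/|ω(t,x)|)³`. Then `False`.
[cite: GigaMiura2011, Thm 1.1 with Rmk 1.4 and §2.1 (HUPS preprint #956 pp. 3–9)] -/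
theorem false_of_mostTimesBulkAlignedExistsAnchor_typeI {ν T : ℝ} (hν : 0 < ν) (hT : 0 < T)
    {u : ℝ → EuclideanSpace ℝ (Fin 3) → EuclideanSpace ℝ (Fin 3)} {p : ℝ → EuclideanSpace ℝ (Fin 3) → ℝ}
    (hsol : IsClassicalNSSolutionOn (Ico 0 T) ν 0 u p) (hLH : IsLerayHopfOn T ν 0 (u 0) u)
    (hslab : ∀ T' < T, ∃ M : ℝ, ∀ t ∈ Icc 0 T', ∀ x, ‖u t x‖ ≤ M)
    (hI : IsTypeIBlowup u T) (hext : ¬ HasSmoothExtensionPast ν 0 u T)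
    {lam0 R0 θ : ℝ} (hlam01 : lam0 < 1) (hR0 : 0 < R0) (hθ : θ < 1)
    (hW : ∀ κ : ℝ, 0 < κ → ∀ ε : ℝ, 0 < ε → ∀ δ : ℝ, 0 < δ → ∃ M : ℝ, 0 < M ∧ ∃ E : Set ℝ,
      (∃ h0 : ℝ, 0 < h0 ∧ ∀ h : ℝ, 0 < h → h < h0 →
        volume (E ∩ Set.Ioo (T - h) T) ≤ ENNReal.ofReal (θ * h)) ∧
      ∀ t ∈ Set.Ico 0 T, t ∉ E → ∀ x : EuclideanSpace ℝ (Fin 3), M ≤ ‖curl (u t) x‖ →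
        κ / (T - t) ≤ ‖curl (u t) x‖ → ∃ e : EuclideanSpace ℝ (Fin 3), ‖e‖ = 1 ∧
          volume {y : EuclideanSpace ℝ (Fin 3) | lam0 * ‖curl (u t) x‖ ≤ ‖curl (u t) y‖ ∧
              ‖x - y‖ ≤ R0 * Real.sqrt (ν / ‖curl (u t) x‖) ∧
              ε < Real.sqrt (1 - (inner ℝ e (‖curl (u t) y‖⁻¹ • curl (u t) y)) ^ 2)}
            ≤ ENNReal.ofReal (δ * Real.sqrt (ν / ‖curl (u t) x‖) ^ 3)) : False := by
  classical
  -- adapted from `false_of_mostTimesWindowBulkAligned_typeI` (`ScaledTopAlignmentMostTimesGlueKit`, p5 g3):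
  -- steps 1–4 verbatim; step 5 builds the anchor field and calls the anchor-field window lemma
  -- Step 1: the flexible zoom, base times `τ_j = T - T/(j+2)`
  set τ : ℕ → ℝ := fun j => T - T / ((j : ℝ) + 2) with hτdef
  have hτ : ∀ j, τ j ∈ Ico 0 T := fun j => by
    have h2 : (0 : ℝ) < (j : ℝ) + 2 := by positivity
    have h3 : T / ((j : ℝ) + 2) ≤ T := by
      rw [div_le_iff₀ h2]; nlinarith [(Nat.cast_nonneg j : (0 : ℝ) ≤ j)]
    have h4 : 0 < T / ((j : ℝ) + 2) := div_pos hT h2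
    simp only [hτdef, mem_Ico]
    constructor <;> linarith
  have hτT : Tendsto τ atTop (𝓝 T) := by
    have h1 : Tendsto (fun j : ℕ => T / ((j : ℝ) + 2)) atTop (𝓝 0) := by
      have h := (tendsto_one_div_add_atTop_nhds_zero_nat (𝕜 := ℝ)).comp (tendsto_add_atTop_nat 1)
      have h' : Tendsto (fun j : ℕ => T * (1 / ((j : ℝ) + 2))) atTop (𝓝 (T * 0)) := by
        refine (h.congr fun j => ?_).const_mul T
        simp only [comp_apply, Nat.cast_add, Nat.cast_one]
        ring
      rw [mul_zero] at h'
      exact h'.congr fun j => by ring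
    have h2 := h1.const_sub T
    rw [sub_zero] at h2
    exact h2
  obtain ⟨φ, -, C, W, xc, lam, hWcl, hW0, hlam, -, hlam0, -, hflex⟩ :=
    typeIZoom_ancientMild_limit_flexible hν hT hsol hLH hslab hI hext hτ hτT
  -- Step 2: a non-unidirectional vorticity end `s < t₁` of `W`
  obtain ⟨t₁, ht₁, hend⟩ := exists_end_curl_not_unidirectional hWcl ⟨-1, by norm_num, 0, hW0⟩
  have hnz : ∀ s < t₁, ∃ y, curl (W s) y ≠ 0 := by
    intro s hs
    by_contra h
    push Not at h
    have he1 : (EuclideanSpace.single (0 : Fin 3) (1 : ℝ) : EuclideanSpace ℝ (Fin 3)) ≠ 0 := by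
      intro h0
      have := congr_arg (fun v : EuclideanSpace ℝ (Fin 3) => v 0) h0
      simp at this
    exact hend s hs ⟨EuclideanSpace.single 0 1, he1, fun y => ⟨0, by rw [h y, zero_smul]⟩⟩
  -- Step 3: the slice interval `[a, b]`, `b = 2 t₁`, `a = N b`, `N (1 - θ) = 3 - θ > 1`, and the floor
  set b : ℝ := 2 * t₁ with hbdef
  have hb0 : b < 0 := by rw [hbdef]; linarith
  have hbt₁ : b < t₁ := by rw [hbdef]; linarith
  set B : ℝ := -b with hBdef
  have hB : 0 < B := by rw [hBdef]; linarith
  have h1θ : 0 < 1 - θ := by linarith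
  set N : ℝ := 2 / (1 - θ) + 1 with hNdef
  have hN1 : 1 < N := by
    have : 0 < 2 / (1 - θ) := div_pos two_pos h1θ
    rw [hNdef]; linarith
  set a : ℝ := N * b with hadef
  have hab : a < b := by
    rw [hadef]; nlinarith
  have hθab : θ * (-a) < b - a := by
    have hNθ : N * (1 - θ) = 3 - θ := by rw [hNdef]; field_simp; ring
    have e : b - a - θ * (-a) = B * (2 - θ) := by
      rw [hadef, hBdef]; linear_combination (-b) * hNθ
    nlinarith [mul_pos hB (show (0 : ℝ) < 2 - θ by linarith)]
  have hma : 0 < -a := by nlinarith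
  have hIcc : ∀ s ∈ Icc a b, s < t₁ := fun s hs => lt_of_le_of_lt hs.2 hbt₁
  obtain ⟨m, hm, hfloor⟩ := exists_curl_floor_Icc hWcl hb0 fun s hs => hnz s (hIcc s hs)
  -- the door at `κ₀ = m B` along the levels `ε_n = δ_n = 1/(n+1)`: thresholds `M n`, sets `E n`, anchors
  have hlev : ∀ n : ℕ, ∃ M : ℝ, 0 < M ∧ ∃ E : Set ℝ, (∃ h0 : ℝ, 0 < h0 ∧ ∀ h : ℝ, 0 < h → h < h0 →
        volume (E ∩ Set.Ioo (T - h) T) ≤ ENNReal.ofReal (θ * h)) ∧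
      ∀ t ∈ Set.Ico 0 T, t ∉ E → ∀ x : EuclideanSpace ℝ (Fin 3), M ≤ ‖curl (u t) x‖ →
        m * B / (T - t) ≤ ‖curl (u t) x‖ → ∃ e : EuclideanSpace ℝ (Fin 3), ‖e‖ = 1 ∧
          volume {y : EuclideanSpace ℝ (Fin 3) | lam0 * ‖curl (u t) x‖ ≤ ‖curl (u t) y‖ ∧
              ‖x - y‖ ≤ R0 * Real.sqrt (ν / ‖curl (u t) x‖) ∧
              1 / ((n : ℝ) + 1) < Real.sqrt (1 - (inner ℝ e (‖curl (u t) y‖⁻¹ • curl (u t) y)) ^ 2)}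
            ≤ ENNReal.ofReal (1 / ((n : ℝ) + 1) * Real.sqrt (ν / ‖curl (u t) x‖) ^ 3) :=
    fun n => hW (m * B) (mul_pos hm hB) (1 / ((n : ℝ) + 1)) (by positivity) (1 / ((n : ℝ) + 1))
      (by positivity)
  choose M hM0 E hEd hgoodn using hlev
  choose h0 hh0 hE using hEd
  -- the ANCHOR FIELD `eF n t x` (unit; the door's anchor where the clause is active, `W(-1,0)/|W(-1,0)|` elsewhere)
  have he₀ : ‖(‖W (-1) 0‖⁻¹ • W (-1) 0 : EuclideanSpace ℝ (Fin 3))‖ = 1 := norm_smul_inv_norm hW0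
  have hanc : ∀ (n : ℕ) (t' : ℝ) (x : EuclideanSpace ℝ (Fin 3)), ∃ e : EuclideanSpace ℝ (Fin 3), ‖e‖ = 1 ∧
      (t' ∈ Set.Ico 0 T → t' ∉ E n → M n ≤ ‖curl (u t') x‖ → m * B / (T - t') ≤ ‖curl (u t') x‖ →
        volume {y : EuclideanSpace ℝ (Fin 3) | lam0 * ‖curl (u t') x‖ ≤ ‖curl (u t') y‖ ∧
            ‖x - y‖ ≤ R0 * Real.sqrt (ν / ‖curl (u t') x‖) ∧
            1 / ((n : ℝ) + 1) < Real.sqrt (1 - (inner ℝ e (‖curl (u t') y‖⁻¹ • curl (u t') y)) ^ 2)}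
          ≤ ENNReal.ofReal (1 / ((n : ℝ) + 1) * Real.sqrt (ν / ‖curl (u t') x‖) ^ 3)) := by
    intro n t' x
    by_cases h : t' ∈ Set.Ico 0 T ∧ t' ∉ E n ∧ M n ≤ ‖curl (u t') x‖ ∧ m * B / (T - t') ≤ ‖curl (u t') x‖
    · obtain ⟨e, he1, hb⟩ := hgoodn n t' h.1 h.2.1 x h.2.2.1 h.2.2.2
      exact ⟨e, he1, fun _ _ _ _ => hb⟩
    · exact ⟨‖W (-1) 0‖⁻¹ • W (-1) 0, he₀, fun h1 h2 h3 h4 => absurd ⟨h1, h2, h3, h4⟩ h⟩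
  choose eF heF1 heFb using hanc
  -- Step 4a: the diagonal over levels, `P n j` = "scale `j` is admissible at level `n`"
  set P : ℕ → ℕ → Prop := fun n j =>
    lam j ^ 2 / ν * (-a) < min (h0 n) T ∧ M n * lam j ^ 2 * ((n : ℝ) + 1) ≤ 1 with hPdef
  have hPev : ∀ n, ∀ᶠ j in atTop, P n j := by
    intro n
    have h1 : Tendsto (fun j => lam j ^ 2 / ν * (-a)) atTop (𝓝 (0 ^ 2 / ν * (-a))) :=
      ((hlam0.pow 2).div_const ν).mul_const (-a)
    rw [zero_pow two_ne_zero, zero_div, zero_mul] at h1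
    have h2 : Tendsto (fun j => M n * lam j ^ 2 * ((n : ℝ) + 1)) atTop
        (𝓝 (M n * 0 ^ 2 * ((n : ℝ) + 1))) := ((hlam0.pow 2).const_mul (M n)).mul_const _
    rw [zero_pow two_ne_zero, mul_zero, zero_mul] at h2
    filter_upwards [h1.eventually_lt_const (lt_min (hh0 n) hT), h2.eventually_lt_const one_pos]
      with j hj1 hj2
    exact ⟨hj1, hj2.le⟩
  have hQev : ∀ n₀ : ℕ, ∀ᶠ j in atTop, ∀ n ∈ Iic n₀, P n j := fun n₀ =>
    (eventually_all_finite (finite_Iic n₀)).2 fun n _ => hPev n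
  set nsel : ℕ → ℕ := fun j => Nat.findGreatest (fun n => ∀ n' ∈ Iic n, P n' j) j with hnseldef
  have hnselP : ∀ᶠ j in atTop, P (nsel j) j := by
    filter_upwards [hQev 0] with j hj
    have hspec : ∀ n' ∈ Iic (nsel j), P n' j :=
      Nat.findGreatest_spec (P := fun n => ∀ n' ∈ Iic n, P n' j) (Nat.zero_le j) hj
    exact hspec (nsel j) (mem_Iic.2 le_rfl)
  have hnsel : Tendsto nsel atTop atTop := by
    refine tendsto_atTop.2 fun n₀ => ?_
    filter_upwards [hQev n₀, eventually_ge_atTop n₀] with j hj hjn₀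
    exact Nat.le_findGreatest (P := fun n => ∀ n' ∈ Iic n, P n' j) hjn₀ hj
  -- Step 4b: slice selection at every admissible scale, then a convergent subsequence
  have hμ : ∀ j, 0 < lam j ^ 2 / ν := fun j => div_pos (pow_pos (hlam j) 2) hν
  have hsel : ∀ j, ∃ s, s ∈ Icc a b ∧ (P (nsel j) j →
      T + lam j ^ 2 * s / ν ∉ E (nsel j) ∧ T + lam j ^ 2 * s / ν ∈ Ico 0 T) := by
    intro j
    by_cases hj : P (nsel j) j
    · obtain ⟨s, hs, hsE⟩ := exists_slice_time_notMem (T := T) (hμ j) hab hb0 hθab (hE (nsel j))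
        (lt_of_lt_of_le hj.1 (min_le_left _ _))
      have e : T + lam j ^ 2 / ν * s = T + lam j ^ 2 * s / ν := by ring
      refine ⟨s, Ioc_subset_Icc_self hs, fun _ => ⟨by rwa [e] at hsE, ?_, ?_⟩⟩
      · have h1 : lam j ^ 2 / ν * a ≤ lam j ^ 2 / ν * s := mul_le_mul_of_nonneg_left hs.1.le (hμ j).le
        have h2 : lam j ^ 2 / ν * (-a) ≤ T := (lt_of_lt_of_le hj.1 (min_le_right _ _)).le
        rw [← e]; nlinarith
      · have h1 : lam j ^ 2 / ν * s < 0 := mul_neg_of_pos_of_neg (hμ j) (lt_of_le_of_lt hs.2 hb0)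
        rw [← e]; linarith
    · exact ⟨b, right_mem_Icc.2 hab.le, fun h => absurd h hj⟩
  choose σ hσmem hσgood using hsel
  obtain ⟨sStar, hsStar, ψ, hψ, hσlim⟩ := isCompact_Icc.tendsto_subseq hσmem
  have hsStar0 : sStar < 0 := lt_of_le_of_lt hsStar.2 hb0
  obtain ⟨j₀, hj₀⟩ := eventually_atTop.1 hnselP
  -- the final index map `k i = ψ (i + j₀)` (so that `k i ≥ j₀`) and the levels `nk i = nsel (k i)`
  set k : ℕ → ℕ := fun i => ψ (i + j₀) with hkdef
  have hk : StrictMono k := fun i i' h => hψ (Nat.add_lt_add_right h j₀)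
  have hkj₀ : ∀ i, j₀ ≤ k i := fun i =>
    le_trans (Nat.le_add_left j₀ i) (hψ.id_le (i + j₀))
  have hPk : ∀ i, P (nsel (k i)) (k i) := fun i => hj₀ _ (hkj₀ i)
  have hgood : ∀ i, T + lam (k i) ^ 2 * σ (k i) / ν ∉ E (nsel (k i)) ∧
      T + lam (k i) ^ 2 * σ (k i) / ν ∈ Ico 0 T := fun i => hσgood (k i) (hPk i)
  have hnk : Tendsto (fun i => nsel (k i)) atTop atTop := hnsel.comp hk.tendsto_atTop
  have hlev0 : Tendsto (fun i => 1 / ((nsel (k i) : ℝ) + 1)) atTop (𝓝 0) :=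
    (tendsto_one_div_add_atTop_nhds_zero_nat (𝕜 := ℝ)).comp hnk
  have hσk : Tendsto (fun i => σ (k i)) atTop (𝓝 sStar) := hσlim.comp (tendsto_add_atTop_nat j₀)
  -- diagonal convergence along `k` (extend the slices off the range of `k` by `s⋆`)
  set Ω : EuclideanSpace ℝ (Fin 3) → EuclideanSpace ℝ (Fin 3) := curl (W sStar) with hΩdef
  have hconv : ∀ y, Tendsto (fun i => (lam (k i) ^ 2 / ν) •
      curl (u (T + lam (k i) ^ 2 * σ (k i) / ν)) (xc (k i) + lam (k i) • y)) atTop (𝓝 (Ω y)) := by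
    intro y
    set σ' : ℕ → ℝ := Function.extend k (fun i => σ (k i)) fun _ => sStar with hσ'def
    have hσ' : Tendsto σ' atTop (𝓝 sStar) := tendsto_extend_of_strictMono hk hσk
    have h := (hflex sStar hsStar0 σ' hσ' y).comp hk.tendsto_atTop
    refine h.congr fun i => ?_
    simp only [comp_apply, hσ'def, hk.injective.extend_apply]
  -- Step 5: the anchor-field window lemma along these times (levels `M (nsel (k i))`), then rigidity
  obtain ⟨y₀, hy₀m⟩ := hfloor sStar hsStar
  have hy₀ : Ω y₀ ≠ 0 := by
    rw [hΩdef]; exact norm_pos_iff.1 (hm.trans hy₀m)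
  have hκ : m * B < ‖Ω y₀‖ * B := mul_lt_mul_of_pos_right hy₀m hB
  have hΩc : Continuous Ω :=
    continuous_curl ((hWcl.contDiff_slice hsStar0).of_le (by exact_mod_cast le_top))
  have hWseq : ∀ ε : ℝ, 0 < ε → ∀ δ : ℝ, 0 < δ → ∃ Ms : ℕ → ℝ,
      Tendsto (fun i => Ms i * lam (k i) ^ 2) atTop (𝓝 0) ∧ ∀ᶠ i in atTop, ∀ x : EuclideanSpace ℝ (Fin 3),
      Ms i ≤ ‖curl (u (T + lam (k i) ^ 2 * σ (k i) / ν)) x‖ →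
      m * B / (T - (T + lam (k i) ^ 2 * σ (k i) / ν)) ≤ ‖curl (u (T + lam (k i) ^ 2 * σ (k i) / ν)) x‖ →
        volume {y : EuclideanSpace ℝ (Fin 3) |
            lam0 * ‖curl (u (T + lam (k i) ^ 2 * σ (k i) / ν)) x‖ ≤
              ‖curl (u (T + lam (k i) ^ 2 * σ (k i) / ν)) y‖ ∧
            ‖x - y‖ ≤ R0 * Real.sqrt (ν / ‖curl (u (T + lam (k i) ^ 2 * σ (k i) / ν)) x‖) ∧
            ε < Real.sqrt (1 - (inner ℝ (eF (nsel (k i)) (T + lam (k i) ^ 2 * σ (k i) / ν) x)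
              (‖curl (u (T + lam (k i) ^ 2 * σ (k i) / ν)) y‖⁻¹ •
                curl (u (T + lam (k i) ^ 2 * σ (k i) / ν)) y)) ^ 2)}
          ≤ ENNReal.ofReal (δ * Real.sqrt (ν / ‖curl (u (T + lam (k i) ^ 2 * σ (k i) / ν)) x‖) ^ 3) := by
    intro ε hε δ hδ
    refine ⟨fun i => M (nsel (k i)), ?_, ?_⟩
    · refine squeeze_zero (fun i => (mul_pos (hM0 _) (pow_pos (hlam _) 2)).le) (fun i => ?_) hlev0
      have hP2 := (hPk i).2
      have hn : (0 : ℝ) < (nsel (k i) : ℝ) + 1 := by positivity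
      show M (nsel (k i)) * lam (k i) ^ 2 ≤ 1 / ((nsel (k i) : ℝ) + 1)
      rw [le_div_iff₀ hn]; exact hP2
    · filter_upwards [hlev0.eventually (Iic_mem_nhds hε), hlev0.eventually (Iic_mem_nhds hδ)]
        with i hiε hiδ x hMx hκx
      have hb := heFb (nsel (k i)) _ x (hgood i).2 (hgood i).1 hMx hκx
      refine le_trans (measure_mono fun y hy => ?_) (le_trans hb (ENNReal.ofReal_le_ofReal ?_))
      · obtain ⟨h1, h2, h3⟩ := hy
        exact ⟨h1, h2, lt_of_le_of_lt hiε h3⟩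
      · exact mul_le_mul_of_nonneg_right hiδ (pow_nonneg (Real.sqrt_nonneg _) 3)
  have hpar : ∀ i, lam (k i) ^ 2 * B ≤ ν * (T - (T + lam (k i) ^ 2 * σ (k i) / ν)) := by
    intro i
    have e : ν * (T - (T + lam (k i) ^ 2 * σ (k i) / ν)) = lam (k i) ^ 2 * (-σ (k i)) := by
      field_simp; ring
    rw [e]
    exact mul_le_mul_of_nonneg_left (by rw [hBdef]; linarith [(hσmem (k i)).2]) (sq_nonneg _)
  obtain ⟨eStar, heStar, U, hUo, hy₀U, hal⟩ :=
    exists_window_cross_anchor_eq_zero_of_anchorBulkAligned_levels (T := T) hν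
    (ω := fun t => curl (u t)) (t := fun i => T + lam (k i) ^ 2 * σ (k i) / ν)
    (xc := fun i => xc (k i)) (lam := fun i => lam (k i)) hlam01 hR0 hB (fun i => hlam (k i))
    (e := fun i x => eF (nsel (k i)) (T + lam (k i) ^ 2 * σ (k i) / ν) x) (fun i x => heF1 _ _ _)
    hWseq hpar hΩc hconv hy₀ hκ
  exact hW0 (eq_zero_of_aligned_window hWcl.hasTypeITimeDecay hWcl.continuousOn_uncurry
    (fun s t hst ht' x => hWcl.mild_eq_heatExtension hst ht' x) (fun t ht' => hWcl.isDivFree ht')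
    hsStar0 heStar hUo ⟨y₀, hy₀U⟩ hal (-1) (by norm_num) 0)

/-- **THE ∃e-BRIDGE: the re-anchored most-times door W3ᵐᵗ-∃e plus NoTypeII gives Clay (A).** Door (= the
planner's rev21 `AprioriMostTimesBulkAlignmentExistsAnchor` VERBATIM, rev21/W3mtE.signature.txt): for every
classical Leray–Hopf solution from a rapidly decaying datum on `[0,T)` there are `λ₀ < 1`, `R₀ > 0`, `θ < 1`
such that for all `κ, ε, δ > 0` some level `M` and some time set `E` of final density `≤ θ` at `T` work: at every
`t ∈ [0,T) ∖ E` and every `x` with `|ω(t,x)| ≥ M`, `≥ κ/(T−t)`, SOME unit vector `e` has the `ε`-misaligned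
(against `e`) part of the relative top set in the window of volume `≤ δ ℓ³`. With NoTypeII (the residual; the
body of `TypeILiouville.TypeIliouvilleNoTypeII`): `NavierStokesRegularity` (through `TypeILiouville.Assembly_holds`,
the slab bound `liouvilleKillsTypeI_exists_bound_Icc` and `false_of_mostTimesBulkAlignedExistsAnchor_typeI`).
The intended `closes` of a re-anchored route: `exact Theorems.navierStokesRegularity_of_mostTimesBulkAlignmentExistsAnchor_of_noTypeII hW hII`.
[cite: GigaMiura2011, Thm 1.1 with Rmk 1.4 and §2.1] -/
theorem navierStokesRegularity_of_mostTimesBulkAlignmentExistsAnchor_of_noTypeII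
    (hW : ∀ (ν T : ℝ), 0 < ν → 0 < T → ∀ (u : ℝ → EuclideanSpace ℝ (Fin 3) → EuclideanSpace ℝ (Fin 3))
      (p : ℝ → EuclideanSpace ℝ (Fin 3) → ℝ), IsClassicalNSSolutionOn (Set.Ico 0 T) ν 0 u p →
      IsLerayHopfOn T ν 0 (u 0) u → HasRapidSpatialDecay (u 0) →
      ∃ lam0 : ℝ, lam0 < 1 ∧ ∃ R0 : ℝ, 0 < R0 ∧ ∃ θ : ℝ, θ < 1 ∧ ∀ κ : ℝ, 0 < κ → ∀ ε : ℝ, 0 < ε →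
        ∀ δ : ℝ, 0 < δ → ∃ M : ℝ, 0 < M ∧ ∃ E : Set ℝ,
        (∃ h0 : ℝ, 0 < h0 ∧ ∀ h : ℝ, 0 < h → h < h0 →
          MeasureTheory.volume (E ∩ Set.Ioo (T - h) T) ≤ ENNReal.ofReal (θ * h)) ∧
        ∀ t ∈ Set.Ico 0 T, t ∉ E → ∀ x : EuclideanSpace ℝ (Fin 3), M ≤ ‖curl (u t) x‖ →
          κ / (T - t) ≤ ‖curl (u t) x‖ → ∃ e : EuclideanSpace ℝ (Fin 3), ‖e‖ = 1 ∧
            MeasureTheory.volume {y : EuclideanSpace ℝ (Fin 3) | lam0 * ‖curl (u t) x‖ ≤ ‖curl (u t) y‖ ∧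
                ‖x - y‖ ≤ R0 * Real.sqrt (ν / ‖curl (u t) x‖) ∧
                ε < Real.sqrt (1 - (inner ℝ e (‖curl (u t) y‖⁻¹ • curl (u t) y)) ^ 2)}
              ≤ ENNReal.ofReal (δ * Real.sqrt (ν / ‖curl (u t) x‖) ^ 3))
    (hII : ∀ (ν T : ℝ), 0 < ν → 0 < T → ∀ (u : ℝ → EuclideanSpace ℝ (Fin 3) → EuclideanSpace ℝ (Fin 3))
      (p : ℝ → EuclideanSpace ℝ (Fin 3) → ℝ), IsMaximalSmoothSolution ν 0 u p T →
      IsLerayHopfOn T ν 0 (u 0) u → HasRapidSpatialDecay (u 0) → IsTypeIBlowup u T) :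
    NavierStokesRegularity := by
  apply Summit.NavierStokesRegularity.NavierStokesRegularity.Theses.TypeILiouville.Assembly_holds
  intro ν T hν hT u p hcl hLH hdec
  by_contra hext
  have hI : IsTypeIBlowup u T := hII ν T hν hT u p ⟨hcl, hext⟩ hLH hdec
  have hbdd : ∀ T' < T, ∃ M : ℝ, ∀ s ∈ Set.Icc 0 T', ∀ x, ‖u s x‖ ≤ M := by
    intro T' hT'
    by_cases h : 0 < T'
    · exact liouvilleKillsTypeI_exists_bound_Icc hν hcl hLH hdec ⟨h, hT'⟩
    · obtain ⟨M, hM⟩ := liouvilleKillsTypeI_exists_bound_Icc hν hcl hLH hdec (T' := T / 2)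
        ⟨by linarith, by linarith⟩
      push Not at h
      exact ⟨M, fun s hs x => hM s ⟨hs.1, by linarith [hs.2]⟩ x⟩
  obtain ⟨lam0, hlam01, R0, hR0, θ, hθ, hfam⟩ := hW ν T hν hT u p hcl hLH hdec
  exact false_of_mostTimesBulkAlignedExistsAnchor_typeI hν hT hcl hLH hbdd hI hext hlam01 hR0 hθ hfam

end Summit.NavierStokesRegularity.NavierStokesRegularity.Theorems
end
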